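import Summits.CriticalPhenomena.PercolationContinuityZ3.Theorems.PercNearOneGluingNoHeavyQuantFarTreeBlockComb
import Summits.CriticalPhenomena.PercolationContinuityZ3.Theorems.PercNearOneGluingNoHeavyQuantBlobWalkTopRoom
import HarnessLib

/-!
# QUANT lane R8, FAR on trees: two-group block-combs with ROOM AT THE TOP (a structural FAR family, no budget)

builds on p205010 (kernel theorem, internal audit signed; external expert review pending)

Support file (`--supports stmt-CriticalPhenomena-4575`), QUANT lane typer seat prim-quant-stmt (gen 14), rung R8 of
`run/shared/lean/prim/quant/LADDER.md`; typer target of the gen-11 lead (lane INBOX 2026-08-20T23:25Z (2), `LEAD-NOTES-G11.md` N22 (3″)(ii)).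
Companion of `…QuantFarTreeBlockCombBottomRoom.lean` (same seat).  Theorems only; no definitions (the `local notation3` `CB[a, p, m]` of
`…QuantBlobWalk.lean`, verbatim), no sorries, standard axioms.  Data as in `Quant.blockComb_count_eq`: a block-comb around `a` in the gate
coordinates of `Quant.FarTreeRow`, blobs = fibres `Q 0 … Q (K−1)` of `P` off the terminal class, root-first, sizes `sz`, private gates `p`, chain
weights `w` (non-increasing along the enumeration), `x = ∏_{P a} q`, terminal `c`.

* `Quant.farTree_blockComb_of_topRoom` — **FAR AT LAYER `j`, NO BUDGET HYPOTHESIS, for every block-comb whose blobs split into an upper group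
  `k < m` (private gates `≥ 1/2`, `x ≤ w (m−1) · p k`, total size `A`) and a lower group `m ≤ k < K` (private gates `≥ 1/2`, `x ≤ w (K−1) · p k`,
  total size `B`) with `2j + 2 ≤ c + B + 2 s₀` and `A ≥ j + 1 + s₀`:** `P(#{y ∈ A : P y open} ≤ j) ≤ 1 − x`
  (`BlobWalk.exchange_of_topRoom` + `Quant.farTree_blockComb_of_exchange`).  With `s₀ = 0` this is the bottom-room family with the (then idle)
  extra condition `A ≥ j + 1`; with `B` small it is lead g11's "ROOM AT THE TOP" (ii) for arbitrary gates `≥ 1/2` within each group.  Together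
  with `Quant.farTree_blockComb_of_bottomRoom` it puts lead g11's two structural regimes of (2L) in the kernel; the (2L) residual (both groups
  short) and gates `< 1/2` remain open (N22 (3″)).
RELATION TO THE LEAD'S FILES: lead g11's `Quant.IndepBlob.twoHeight_exchange_of_topRoom` (`…QuantTwoHeightFar.lean`, p240695, simultaneous and
independent; `…QuantTwoHeightFarTopHeavy.lean` pending) is the two-height exchange inequality in the Finset-weight vocabulary; this file is the
`Quant.FarTreeRow`-shape statement for two-GROUP block-combs (several chain heights inside each group; walk side `…QuantBlobWalkTopRoom.lean`).
[this work]; [cite: KozmaNitzan2024, Conjecture 3 (p. 15)] (the gluing rows `Quant.FarTreeRow` serves).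
-/

noncomputable section

namespace Summit.CriticalPhenomena.PercolationContinuityZ3.Theorems

namespace Quant

open Finset MeasureTheory
open Literature.Probability.LatticeModels
open Literature.Probability.Percolation
open scoped Classical

/-- `CB[a, p, m] t` = probability that the open mass of the first `m` blobs (sizes `a`, gates `p`) is `≤ t` (the recursion of
`…QuantBlobWalk.lean`, verbatim). -/
local notation3 "CB[" a ", " p ", " m "]" =>
  (Nat.rec (motive := fun _ => ℤ → ℝ) (fun t => if (0 : ℤ) ≤ t then (1 : ℝ) else 0)
    (fun n f t => (p : ℕ → ℝ) n * f (t - ((a : ℕ → ℕ) n : ℤ)) + (1 - (p : ℕ → ℝ) n) * f t) (m : ℕ))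

variable {ι : Type*} [Fintype ι] [DecidableEq ι]

/-- **FAR at layer `j` for two-group block-combs with ROOM AT THE TOP — no budget hypothesis.**  Data as in `Quant.blockComb_count_eq`; an upper
group of blobs `k < m` with private gates `≥ 1/2` and `x ≤ w (m−1) · p k`, a lower group `m ≤ k < K` (`m < K`) with private gates `≥ 1/2` and
`x ≤ w (K−1) · p k`; `2j + 2 ≤ c + Σ_{m≤k<K} sz k + 2 s₀` and `j + 1 + s₀ ≤ Σ_{k<m} sz k`.  Then `P(#{y ∈ A : P y open} ≤ j) ≤ 1 − x`. [this work] -/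
theorem farTree_blockComb_of_topRoom (P : ι → Finset ι) (q : ι → unitInterval) (a : ι) (x : ℝ)
    (hx : x = ∏ y ∈ P a, (q y : ℝ)) (K : ℕ) (A : Finset ι) (Q : ℕ → Finset ι) (sz : ℕ → ℕ) (c : ℕ) (p w : ℕ → ℝ)
    (ha : a ∈ A) (hc : c = (A.filter fun y => P y = P a).card)
    (hsz : ∀ k, k < K → sz k = (A.filter fun y => P y = Q k).card)
    (hcover : ∀ y ∈ A, P y = P a ∨ ∃ k, k < K ∧ P y = Q k)
    (hQne : ∀ k, k < K → Q k ≠ P a)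
    (hinj : ∀ k k', k < K → k' < K → Q k = Q k' → k = k')
    (hmono : ∀ k k', k ≤ k' → k' < K → Q k ∩ P a ⊆ Q k' ∩ P a)
    (hdisj : ∀ k k', k < K → k' < K → k ≠ k' → Q k ∩ Q k' ⊆ P a)
    (hpdef : ∀ k, p k = ∏ y ∈ Q k \ P a, (q y : ℝ))
    (hwdef : ∀ k, w k = ∏ y ∈ Q k ∩ P a, (q y : ℝ)) (j : ℕ) (m : ℕ) (hmK : m < K) (s₀ : ℕ)
    (hgrp₁ : ∀ k, k < m → 1 / 2 ≤ p k ∧ x ≤ w (m - 1) * p k)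
    (hgrp₂ : ∀ k, m ≤ k → k < K → 1 / 2 ≤ p k ∧ x ≤ w (K - 1) * p k)
    (hB : 2 * j + 2 ≤ c + ∑ k ∈ Finset.Ico m K, sz k + 2 * s₀)
    (hA : j + 1 + s₀ ≤ ∑ k ∈ Finset.range m, sz k) :
    (prodBernoulli q).real
        {ω : Set ι | (A.filter fun y => ((P y : Finset ι) : Set ι) ⊆ ω).card ≤ j} ≤ 1 - x := by
  have hq0 : ∀ y, (0 : ℝ) ≤ q y := fun y => (q y).2.1
  have hq1 : ∀ y, (q y : ℝ) ≤ 1 := fun y => (q y).2.2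
  have hprod01 : ∀ s : Finset ι, 0 ≤ ∏ y ∈ s, (q y : ℝ) ∧ ∏ y ∈ s, (q y : ℝ) ≤ 1 := fun s =>
    ⟨Finset.prod_nonneg fun y _ => hq0 y, Finset.prod_le_one (fun y _ => hq0 y) fun y _ => hq1 y⟩
  have hx0 : 0 ≤ x := by rw [hx]; exact (hprod01 _).1
  have hp01 : ∀ k, 0 ≤ p k ∧ p k ≤ 1 := fun k => by rw [hpdef k]; exact hprod01 _
  -- chain weights are non-increasing along the enumeration
  have hwmono : ∀ k k', k ≤ k' → k' < K → w k' ≤ w k := by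
    intro k k' hkk' hk'
    rw [hwdef k, hwdef k']
    exact Finset.prod_le_prod_of_subset_of_le_one (hmono k k' hkk' hk') (fun y _ => hq0 y) fun y _ _ => hq1 y
  refine farTree_blockComb_of_exchange P q a x hx K A Q sz c p w ha hc hsz hcover hQne hinj hmono hdisj hpdef hwdef j ?_
  exact BlobWalk.exchange_of_topRoom sz p hp01 K m hmK j c s₀ x w hx0
    (fun k hk => hwmono k (m - 1) (by omega) (by omega)) (fun k hk => hwmono k (K - 1) (by omega) (by omega))
    hgrp₁ hgrp₂ hB hA

end Quant

end Summit.CriticalPhenomena.PercolationContinuityZ3.Theorems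

end
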